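import Mathlib
import Summits.Ventures.PercRepro2.Graph
import Summits.Ventures.PercRepro2.Exploration
import Summits.Ventures.PercRepro2.Harris
import Summits.Ventures.PercRepro2.GibbsPAJoint
import Summits.Ventures.PercRepro2.SepClusterJoint
import Summits.Ventures.PercRepro2.SepClusterSupport
import Summits.Ventures.PercRepro2.SepClusterHarris
import Summits.Ventures.PercRepro2.SepFamJoint
import Summits.Ventures.PercRepro2.SepFamSupport
import Summits.Ventures.PercRepro2.SepFamHarris
import Summits.Ventures.PercRepro2.SepFamPA
import Summits.Ventures.PercRepro2.SepFamCross

/-!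
# The conditional BK inequality (G2) for all edge weights in `[0, 1]` (blind cell PercRepro2,
p3 g12, 2026-08-27; `proofs/P3-G2.md` §3 Step 4, the density remark)

`sep_conn_fam` assumes `0 < p e < 1`.  Both sides of the inequality are polynomials in the
weights (`prob` is a finite sum of products of `edgeFactor`s), hence continuous; along the path
`q t = (1 − t) p + t/2`, `t ↓ 0`, the weights are interior and `q t → p`, so the inequality
passes to every `p ∈ [0, 1]^E` (`sep_conn_fam_closed`).  Own work; standard axioms.
-/

namespace Summit.Ventures.PercRepro2

namespace SepPA

open Finset Classical Filter Topology

section Closed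

variable {V : Type*} {E : Type*} [Fintype V] [Fintype E] [DecidableEq E]
variable (ends : E → Sym2 V)

omit [Fintype V] [DecidableEq E] in
/-- The weight of a configuration is continuous in the edge weights. -/
lemma continuous_weight (ω : Config E) : Continuous (fun q : E → ℝ => weight q ω) := by
  unfold weight
  apply continuous_finsetProd
  intro e _
  unfold edgeFactor
  cases hb : ω e
  · simp only [Bool.false_eq_true, ↓reduceIte]
    exact continuous_const.sub (continuous_apply e)
  · simp only [↓reduceIte]
    exact continuous_apply e

omit [Fintype V] in
/-- The probability of an event is continuous in the edge weights. -/
lemma continuous_prob (A : Set (Config E)) : Continuous (fun q : E → ℝ => prob q A) := by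
  have : (fun q : E → ℝ => prob q A) =
      fun q => ∑ ω ∈ Finset.univ.filter (· ∈ A), weight q ω := by
    funext q
    exact prob_eq_sum_filter q A
  rw [this]
  exact continuous_finsetSum _ (fun ω _ => continuous_weight ω)

/-- **(G2) for all edge weights in `[0, 1]`**: for `{a, b}` disjoint from `{c, d}` and
`S = {{a,b} ↮ {c,d}}`, `P(S) · P(S ∧ a ↔ b ∧ c ↔ d) ≤ P(S ∧ a ↔ b) · P(S ∧ c ↔ d)`. -/
theorem sep_conn_fam_closed (p : E → ℝ) (hp : ∀ e, 0 ≤ p e ∧ p e ≤ 1) (a b c d : V)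
    (hXY : Disjoint ({a, b} : Finset V) {c, d}) :
    prob p (sepFam ends {a, b} {c, d}) *
      prob p (sepFam ends {a, b} {c, d} ∩ (connEvent ends a b ∩ connEvent ends c d)) ≤
    prob p (sepFam ends {a, b} {c, d} ∩ connEvent ends a b) *
      prob p (sepFam ends {a, b} {c, d} ∩ connEvent ends c d) := by
  set S := sepFam ends {a, b} {c, d}
  set A := connEvent ends a b
  set B := connEvent ends c d
  -- the gap as a continuous function of the weights
  let F : (E → ℝ) → ℝ := fun q => prob q (S ∩ A) * prob q (S ∩ B) - prob q S * prob q (S ∩ (A ∩ B))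
  have hF : Continuous F :=
    ((continuous_prob (S ∩ A)).mul (continuous_prob (S ∩ B))).sub
      ((continuous_prob S).mul (continuous_prob (S ∩ (A ∩ B))))
  -- the interior path
  let q : ℝ → (E → ℝ) := fun t e => (1 - t) * p e + t * (1 / 2)
  have hq : Continuous q := by
    apply continuous_pi
    intro e
    exact (continuous_const.sub continuous_id).mul continuous_const |>.add
      (continuous_id.mul continuous_const)
  have hq0 : q 0 = p := by
    funext e
    simp [q]
  have hint : ∀ t ∈ Set.Ioo (0 : ℝ) 1, ∀ e, 0 < q t e ∧ q t e < 1 := by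
    intro t ht e
    obtain ⟨h0, h1⟩ := ht
    obtain ⟨hp0, hp1⟩ := hp e
    constructor
    · simp only [q]
      nlinarith
    · simp only [q]
      nlinarith
  have hpos : ∀ t ∈ Set.Ioo (0 : ℝ) 1, 0 ≤ F (q t) := by
    intro t ht
    have := sep_conn_fam ends (q t) (hint t ht) a b c d hXY
    simp only [F]
    linarith
  -- pass to the limit `t ↓ 0`
  have hlim : Tendsto (fun t => F (q t)) (𝓝[>] (0 : ℝ)) (𝓝 (F (q 0))) :=
    tendsto_nhdsWithin_of_tendsto_nhds ((hF.comp hq).continuousAt.tendsto)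
  have hev : ∀ᶠ t in 𝓝[>] (0 : ℝ), 0 ≤ F (q t) :=
    Filter.eventually_of_mem (Ioo_mem_nhdsGT one_pos) (fun t ht => hpos t ht)
  have h0 : 0 ≤ F (q 0) := ge_of_tendsto hlim hev
  rw [hq0] at h0
  simp only [F] at h0
  linarith

end Closed

end SepPA

end Summit.Ventures.PercRepro2
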